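import Summits.FinalStateConjecture.FinalStateConjecture.Theorems.EIHFluxBalanceInertialRecessionBoostAlgebra
import Summits.FinalStateConjecture.FinalStateConjecture.Theorems.EIHFluxBalanceInertialRecessionCalculus
import Mathlib.Analysis.Calculus.ContDiff.Bounds

/-!
# Route EIHFluxBalance — `InertialRecession`: calculus of the honest placement map

Helper file for the crux `stmt-FinalStateConjecture-10166`
(`Summit.FinalStateConjecture.FinalStateConjecture.Theses.EIHFluxBalance.InertialRecession`).

On the honest zone the Fermi-type re-charting map of an `a = 0` hole is the **honest placement**
`A(x') = (x'⁰, ξ(x'⁰) + L(x'⁰) y̲)`, `y̲ = (Λ∞⁻¹ x')~`, `Λ∞ = boost V`, with `ξ` the painted centre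
and `L(t) = L_{v(t)}` the rest-offset map of the painted lab velocity. Near-zone convergence of
the hole chart `Φ ∘ A` needs `DA → 1` in `C²` along the slabs; this file provides the raw
calculus:
* `hasFDerivAt_honestMap` — `DA(x') = e₀ ⊗ dx⁰ + (0, (ξ'(t) + L'(t) y̲) dx⁰ + L(t) d y̲)`;
* `frozen_eq_id` — with frozen data (`ξ' = V`, `L = L_V`, `L' = 0`) this is the identity
  (`boost(V) y = (w, wV + L_V y̲)`);
* `fderiv_honestMap_sub_id`, `norm_fderiv_honestMap_sub_id_le'` (registered form unprimed) —
  `‖DA − 1‖ ≤ ‖ξ' − V‖ + ‖L'‖ ‖y̲‖ + ‖L − L_V‖ ‖Λ∞⁻¹‖`;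
* `norm_iteratedFDeriv_honestMap_le'` (registered form unprimed) — for `j ≥ 2`,
  `‖Dʲ A‖ ≤ ‖ξ⁽ʲ⁾‖ + ‖L⁽ʲ⁾‖ ‖y̲‖ + j ‖L⁽ʲ⁻¹⁾‖ ‖Λ∞⁻¹‖` (all data evaluated at `t = x'⁰`).
-/

noncomputable section

open scoped Topology ContDiff InnerProductSpace BigOperators
open Filter Set Metric Function TopologicalSpace Literature.Geometry.Lorentzian

namespace Summit.FinalStateConjecture.FinalStateConjecture.Theorems

/-! ### Small operator-norm facts -/

/-- `‖(0, z)‖ = ‖z‖`: the slice embedding is an isometry. [folklore] -/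
theorem norm_spaceEmbed (z : E3) : ‖E4.spaceEmbed z‖ = ‖z‖ := by
  rw [E4.spaceEmbed_apply, norm_eq_spatialNorm_of_apply_zero_eq_zero (E4.ofTimeSpace_apply_zero 0 z),
    E4.spatialNorm_ofTimeSpace]

/-- `‖spaceEmbed‖ ≤ 1`. [folklore] -/
theorem norm_spaceEmbedCLM_le : ‖(E4.spaceEmbed : E3 →L[ℝ] E4)‖ ≤ 1 :=
  ContinuousLinearMap.opNorm_le_bound _ zero_le_one fun z ↦ by rw [norm_spaceEmbed, one_mul]

/-- `‖dx⁰‖ ≤ 1`. [folklore] -/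
theorem norm_proj_zero_le : ‖(EuclideanSpace.proj (0 : Fin 4) : E4 →L[ℝ] ℝ)‖ ≤ 1 := by
  refine ContinuousLinearMap.opNorm_le_bound _ zero_le_one fun y ↦ ?_
  rw [one_mul]
  exact PiLp.norm_apply_le y 0

/-- `‖w ⊗ dx⁰‖ ≤ ‖w‖`. [folklore] -/
theorem norm_smulRight_proj_zero_le {F : Type*} [NormedAddCommGroup F] [NormedSpace ℝ F] (w : F) :
    ‖(EuclideanSpace.proj (0 : Fin 4) : E4 →L[ℝ] ℝ).smulRight w‖ ≤ ‖w‖ := by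
  rw [ContinuousLinearMap.norm_smulRight_apply]
  calc ‖(EuclideanSpace.proj (0 : Fin 4) : E4 →L[ℝ] ℝ)‖ * ‖w‖ ≤ 1 * ‖w‖ :=
        mul_le_mul_of_nonneg_right norm_proj_zero_le (norm_nonneg w)
    _ = ‖w‖ := one_mul _

/-- `‖(·)~‖ ≤ 1` as an operator `E4 → E3`. [folklore] -/
theorem norm_spatialCLM_le : ‖(E4.spatial : E4 →L[ℝ] E3)‖ ≤ 1 := by
  refine ContinuousLinearMap.opNorm_le_bound _ zero_le_one fun y ↦ ?_
  rw [one_mul]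
  have h := norm_sq_eq_sq_add_spatialNorm_sq y
  have h1 : E4.spatialNorm y ≤ ‖y‖ := by
    nlinarith [norm_nonneg y, E4.spatialNorm_nonneg y, sq_nonneg (y 0)]
  exact h1

/-- Iterated derivatives of a continuous linear map: order `0`. [folklore] -/
theorem norm_iteratedFDeriv_clm_zero {F : Type*} [NormedAddCommGroup F] [NormedSpace ℝ F]
    (S : E4 →L[ℝ] F) (x : E4) : ‖iteratedFDeriv ℝ 0 S x‖ = ‖S x‖ := by
  rw [norm_iteratedFDeriv_zero]

/-- Iterated derivatives of a continuous linear map: order `1`. [folklore] -/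
theorem norm_iteratedFDeriv_clm_one {F : Type*} [NormedAddCommGroup F] [NormedSpace ℝ F]
    (S : E4 →L[ℝ] F) (x : E4) : ‖iteratedFDeriv ℝ 1 S x‖ ≤ ‖S‖ := by
  rw [← norm_iteratedFDeriv_fderiv, norm_iteratedFDeriv_zero, S.fderiv]

/-- Iterated derivatives of a continuous linear map: orders `≥ 2` vanish. [folklore] -/
theorem iteratedFDeriv_clm_add_two {F : Type*} [NormedAddCommGroup F] [NormedSpace ℝ F]
    (S : E4 →L[ℝ] F) (x : E4) (l : ℕ) : iteratedFDeriv ℝ (l + 2) S x = 0 := by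
  rw [iteratedFDeriv_succ_eq_comp_right]
  have h : iteratedFDeriv ℝ (l + 1) (fun y ↦ fderiv ℝ (S : E4 → F) y) x = 0 := by
    have hfd : (fun y ↦ fderiv ℝ (S : E4 → F) y) = fun _ ↦ S := by funext y; exact S.fderiv
    rw [hfd, iteratedFDeriv_const_of_ne (Nat.succ_ne_zero l)]
    rfl
  rw [comp_apply, h]
  exact (continuousMultilinearCurryRightEquiv' ℝ (l + 1) E4 F).symm.map_zero

/-! ### The honest placement map -/

section HonestMap

variable {V : E3} (hV : ‖V‖ < 1) {ξ : ℝ → E3} {Lv : ℝ → E3 →L[ℝ] E3} {Ah : E4 → E4}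
  (hAh : ∀ x : E4, Ah x = E4.ofTimeSpace (x 0) (ξ (x 0) +
    Lv (x 0) (E4.spatial ((Lorentz.boost V hV : E4 ≃L[ℝ] E4).symm x))))
  (hξ : ContDiff ℝ ∞ ξ) (hLv : ContDiff ℝ ∞ Lv)

include hAh in
/-- Splitting of the honest placement into its three pieces. [folklore] -/
theorem honestMap_eq_add : Ah = (fun x : E4 ↦ (x 0) • E4.basisVector 0) +
    (fun x : E4 ↦ E4.spaceEmbed (ξ (x 0))) +
    fun x : E4 ↦ E4.spaceEmbed (Lv (x 0)
      ((E4.spatial.comp ((Lorentz.boost V hV : E4 ≃L[ℝ] E4).symm : E4 →L[ℝ] E4)) x)) := by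
  funext x
  rw [hAh x, E4.ofTimeSpace_eq_smul_add']
  simp only [Pi.add_apply, map_add, ContinuousLinearMap.comp_apply, ContinuousLinearEquiv.coe_coe]
  abel

include hAh hξ hLv in
/-- The honest placement is smooth. [folklore] -/
theorem contDiff_honestMap : ContDiff ℝ ∞ Ah := by
  rw [honestMap_eq_add hV hAh]
  have h0 : ContDiff ℝ ∞ fun y : E4 ↦ y 0 := (EuclideanSpace.proj (0 : Fin 4) : E4 →L[ℝ] ℝ).contDiff
  refine ((h0.smul contDiff_const).add (E4.spaceEmbed.contDiff.comp (hξ.comp h0))).add ?_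
  exact E4.spaceEmbed.contDiff.comp ((hLv.comp h0).clm_apply
    (E4.spatial.comp ((Lorentz.boost V hV : E4 ≃L[ℝ] E4).symm : E4 →L[ℝ] E4)).contDiff)

include hAh hξ hLv in
/-- **The differential of the honest placement**:
`DA(x') = e₀ ⊗ dx⁰ + (0, ·) ∘ ((ξ'(t) + L'(t) y̲) ⊗ dx⁰ + L(t) ∘ (Λ∞⁻¹ ·)~)`, `t = x'⁰`,
`y̲ = (Λ∞⁻¹x')~`. [folklore] -/
theorem hasFDerivAt_honestMap (x : E4) :
    HasFDerivAt Ah ((EuclideanSpace.proj (0 : Fin 4) : E4 →L[ℝ] ℝ).smulRight (E4.basisVector 0) +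
      E4.spaceEmbed.comp
        ((EuclideanSpace.proj (0 : Fin 4) : E4 →L[ℝ] ℝ).smulRight
            (deriv ξ (x 0) + deriv Lv (x 0)
              (E4.spatial ((Lorentz.boost V hV : E4 ≃L[ℝ] E4).symm x))) +
          (Lv (x 0)).comp (E4.spatial.comp
            ((Lorentz.boost V hV : E4 ≃L[ℝ] E4).symm : E4 →L[ℝ] E4)))) x := by
  set Sp : E4 →L[ℝ] E3 := E4.spatial.comp ((Lorentz.boost V hV : E4 ≃L[ℝ] E4).symm : E4 →L[ℝ] E4)
    with hSp
  set p0 : E4 →L[ℝ] ℝ := (EuclideanSpace.proj (0 : Fin 4) : E4 →L[ℝ] ℝ) with hp0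
  rw [honestMap_eq_add hV hAh]
  have hd0 : HasFDerivAt (fun y : E4 ↦ y 0) p0 x := p0.hasFDerivAt
  have hξd : HasDerivAt ξ (deriv ξ (x 0)) (x 0) := (hξ.differentiable (by simp) _).hasDerivAt
  have hLd : HasDerivAt Lv (deriv Lv (x 0)) (x 0) := (hLv.differentiable (by simp) _).hasDerivAt
  -- piece 1
  have h1 : HasFDerivAt (fun y : E4 ↦ (y 0) • E4.basisVector 0) (p0.smulRight (E4.basisVector 0)) x :=
    hd0.smul_const _
  -- piece 2
  have h2' : HasFDerivAt (fun y : E4 ↦ ξ (y 0))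
      ((ContinuousLinearMap.smulRight (1 : ℝ →L[ℝ] ℝ) (deriv ξ (x 0))).comp p0) x :=
    hξd.hasFDerivAt.comp x hd0
  have h2 : HasFDerivAt (fun y : E4 ↦ E4.spaceEmbed (ξ (y 0)))
      (E4.spaceEmbed.comp ((ContinuousLinearMap.smulRight (1 : ℝ →L[ℝ] ℝ) (deriv ξ (x 0))).comp p0))
      x := E4.spaceEmbed.hasFDerivAt.comp x h2'
  -- piece 3
  have hc : HasFDerivAt (fun y : E4 ↦ Lv (y 0))
      ((ContinuousLinearMap.smulRight (1 : ℝ →L[ℝ] ℝ) (deriv Lv (x 0))).comp p0) x :=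
    hLd.hasFDerivAt.comp x hd0
  have hu : HasFDerivAt (fun y : E4 ↦ Sp y) Sp x := Sp.hasFDerivAt
  have h3' := hc.clm_apply hu
  have h3 := E4.spaceEmbed.hasFDerivAt.comp x h3'
  have hsum := (h1.add h2).add h3
  refine hsum.congr_fderiv ?_
  refine ContinuousLinearMap.ext fun δ ↦ ?_
  simp only [add_apply, ContinuousLinearMap.comp_apply,
    ContinuousLinearMap.smulRight_apply, ContinuousLinearMap.flip_apply, smul_apply,
    one_apply_eq_self, map_add, map_smul, smul_add, hSp, ContinuousLinearEquiv.coe_coe]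
  abel

/-- **Frozen data give the identity**: `e₀ ⊗ dx⁰ + (0, ·) ∘ (V ⊗ dx⁰ + L_V ∘ (Λ∞⁻¹ ·)~) = 1`
(from `boost(V) y = (w, wV + L_V y̲)`, `w = (boost(V) y)⁰`). [folklore] -/
theorem frozen_eq_id :
    (EuclideanSpace.proj (0 : Fin 4) : E4 →L[ℝ] ℝ).smulRight (E4.basisVector 0) +
      E4.spaceEmbed.comp
        ((EuclideanSpace.proj (0 : Fin 4) : E4 →L[ℝ] ℝ).smulRight V +
          (ContinuousLinearMap.id ℝ E3 -
            (Lorentz.gamma V / (Lorentz.gamma V + 1)) • (innerSL ℝ V).smulRight V).comp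
            (E4.spatial.comp ((Lorentz.boost V hV : E4 ≃L[ℝ] E4).symm : E4 →L[ℝ] E4))) =
      ContinuousLinearMap.id ℝ E4 := by
  refine ContinuousLinearMap.ext fun δ ↦ ?_
  set y : E4 := (Lorentz.boost V hV : E4 ≃L[ℝ] E4).symm δ with hy
  have hδ : δ = Lorentz.boostCLM V y := by
    rw [hy, ← Lorentz.coe_boost_apply hV, ContinuousLinearEquiv.apply_symm_apply]
  have hδ0 : δ 0 = Lorentz.gamma V * (y 0 + inner ℝ V (E4.spatial y)) := by
    rw [hδ, Lorentz.boostCLM_apply_zero]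
  have key := boostCLM_eq_ofTimeSpace_restOffset' V y
  rw [← hδ0, ← hδ] at key
  conv_rhs => rw [ContinuousLinearMap.id_apply, key, E4.ofTimeSpace_eq_smul_add']
  simp only [add_apply, ContinuousLinearMap.comp_apply,
    ContinuousLinearMap.smulRight_apply, ContinuousLinearEquiv.coe_coe, map_add, map_smul,
    restOffsetCLM_apply, ← hy]
  rfl

include hAh hξ hLv in
/-- **`DA − 1`** for the honest placement:
`DA(x') − 1 = (0, ·) ∘ ((ξ'(t) − V + L'(t) y̲) ⊗ dx⁰ + (L(t) − L_V) ∘ (Λ∞⁻¹ ·)~)`. [folklore] -/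
theorem fderiv_honestMap_sub_id (x : E4) :
    fderiv ℝ Ah x - ContinuousLinearMap.id ℝ E4 =
      E4.spaceEmbed.comp
        ((EuclideanSpace.proj (0 : Fin 4) : E4 →L[ℝ] ℝ).smulRight
            (deriv ξ (x 0) - V + deriv Lv (x 0)
              (E4.spatial ((Lorentz.boost V hV : E4 ≃L[ℝ] E4).symm x))) +
          (Lv (x 0) - (ContinuousLinearMap.id ℝ E3 -
            (Lorentz.gamma V / (Lorentz.gamma V + 1)) • (innerSL ℝ V).smulRight V)).comp
            (E4.spatial.comp ((Lorentz.boost V hV : E4 ≃L[ℝ] E4).symm : E4 →L[ℝ] E4))) := by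
  rw [(hasFDerivAt_honestMap hV hAh hξ hLv x).fderiv]
  conv_lhs => rw [← frozen_eq_id hV]
  refine ContinuousLinearMap.ext fun δ ↦ ?_
  simp only [sub_apply, add_apply,
    ContinuousLinearMap.comp_apply, ContinuousLinearMap.smulRight_apply, map_add, map_sub,
    map_smul, smul_add, smul_sub, smul_apply]
  abel

include hAh hξ hLv in
/-- **`‖DA − 1‖ ≤ ‖ξ'(t) − V‖ + ‖L'(t)‖ ‖y̲‖ + ‖L(t) − L_V‖ ‖Λ∞⁻¹‖`.** [folklore] -/
theorem norm_fderiv_honestMap_sub_id_le' (x : E4) :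
    ‖fderiv ℝ Ah x - ContinuousLinearMap.id ℝ E4‖ ≤
      ‖deriv ξ (x 0) - V‖ +
        ‖deriv Lv (x 0)‖ * ‖E4.spatial ((Lorentz.boost V hV : E4 ≃L[ℝ] E4).symm x)‖ +
        ‖Lv (x 0) - (ContinuousLinearMap.id ℝ E3 -
            (Lorentz.gamma V / (Lorentz.gamma V + 1)) • (innerSL ℝ V).smulRight V)‖ *
          ‖((Lorentz.boost V hV : E4 ≃L[ℝ] E4).symm : E4 →L[ℝ] E4)‖ := by
  rw [fderiv_honestMap_sub_id hV hAh hξ hLv x]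
  set Sp : E4 →L[ℝ] E3 := E4.spatial.comp ((Lorentz.boost V hV : E4 ≃L[ℝ] E4).symm : E4 →L[ℝ] E4)
    with hSp
  have hSpn : ‖Sp‖ ≤ ‖((Lorentz.boost V hV : E4 ≃L[ℝ] E4).symm : E4 →L[ℝ] E4)‖ := by
    refine (ContinuousLinearMap.opNorm_comp_le _ _).trans ?_
    have h1 : ‖(E4.spatial : E4 →L[ℝ] E3)‖ ≤ 1 := norm_spatialCLM_le
    calc ‖(E4.spatial : E4 →L[ℝ] E3)‖ * ‖((Lorentz.boost V hV : E4 ≃L[ℝ] E4).symm : E4 →L[ℝ] E4)‖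
        ≤ 1 * ‖((Lorentz.boost V hV : E4 ≃L[ℝ] E4).symm : E4 →L[ℝ] E4)‖ :=
          mul_le_mul_of_nonneg_right h1 (norm_nonneg _)
      _ = _ := one_mul _
  refine (ContinuousLinearMap.opNorm_comp_le _ _).trans ?_
  refine (mul_le_mul_of_nonneg_right norm_spaceEmbedCLM_le (norm_nonneg _)).trans ?_
  rw [one_mul]
  refine (norm_add_le _ _).trans (add_le_add ?_ ?_)
  · refine (norm_smulRight_proj_zero_le _).trans ?_
    refine (norm_add_le _ _).trans (add_le_add le_rfl ?_)
    exact ContinuousLinearMap.le_opNorm _ _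
  · exact (ContinuousLinearMap.opNorm_comp_le _ _).trans
      (mul_le_mul_of_nonneg_left hSpn (norm_nonneg _))

include hAh hξ hLv in
/-- **Higher derivatives of the honest placement**: for `j ≥ 2`,
`‖Dʲ A(x')‖ ≤ ‖ξ⁽ʲ⁾(t)‖ + ‖L⁽ʲ⁾(t)‖ ‖y̲‖ + j ‖L⁽ʲ⁻¹⁾(t)‖ ‖Λ∞⁻¹‖` (the linear piece has no second
derivative; Leibniz for `L(t) y̲` with `D² y̲ = 0`). [folklore] -/
theorem norm_iteratedFDeriv_honestMap_le' (x : E4) {j : ℕ} (hj : 2 ≤ j) :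
    ‖iteratedFDeriv ℝ j Ah x‖ ≤
      ‖iteratedDeriv j ξ (x 0)‖ +
        ‖iteratedDeriv j Lv (x 0)‖ * ‖E4.spatial ((Lorentz.boost V hV : E4 ≃L[ℝ] E4).symm x)‖ +
        j * ‖iteratedDeriv (j - 1) Lv (x 0)‖ *
          ‖((Lorentz.boost V hV : E4 ≃L[ℝ] E4).symm : E4 →L[ℝ] E4)‖ := by
  obtain ⟨l, rfl⟩ := Nat.exists_eq_add_of_le' hj
  have hl : ((l + 2 : ℕ) : WithTop ℕ∞) ≤ ∞ := WithTop.coe_le_coe.mpr le_top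
  have hl1 : ((l + 1 : ℕ) : WithTop ℕ∞) ≤ ∞ := WithTop.coe_le_coe.mpr le_top
  rw [honestMap_eq_add hV hAh]
  set Sp : E4 →L[ℝ] E3 := E4.spatial.comp ((Lorentz.boost V hV : E4 ≃L[ℝ] E4).symm : E4 →L[ℝ] E4)
    with hSp
  have h0 : ContDiff ℝ ∞ fun y : E4 ↦ y 0 := (EuclideanSpace.proj (0 : Fin 4) : E4 →L[ℝ] ℝ).contDiff
  have hf1 : ContDiff ℝ ∞ fun y : E4 ↦ (y 0) • E4.basisVector 0 := h0.smul contDiff_const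
  have hf2 : ContDiff ℝ ∞ fun y : E4 ↦ E4.spaceEmbed (ξ (y 0)) :=
    E4.spaceEmbed.contDiff.comp (hξ.comp h0)
  have hLp : ContDiff ℝ ∞ fun y : E4 ↦ Lv (y 0) := hLv.comp h0
  have hin : ContDiff ℝ ∞ fun y : E4 ↦ Lv (y 0) (Sp y) := hLp.clm_apply Sp.contDiff
  have hf3 : ContDiff ℝ ∞ fun y : E4 ↦ E4.spaceEmbed (Lv (y 0) (Sp y)) :=
    E4.spaceEmbed.contDiff.comp hin
  have hf12 : ContDiffAt ℝ (l + 2 : ℕ)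
      ((fun y : E4 ↦ (y 0) • E4.basisVector 0) + fun y : E4 ↦ E4.spaceEmbed (ξ (y 0))) x :=
    (hf1.add hf2).contDiffAt.of_le hl
  rw [iteratedFDeriv_add_apply hf12 (hf3.contDiffAt.of_le hl),
    iteratedFDeriv_add_apply (hf1.contDiffAt.of_le hl) (hf2.contDiffAt.of_le hl)]
  -- piece 1 vanishes
  have e1 : iteratedFDeriv ℝ (l + 2) (fun y : E4 ↦ (y 0) • E4.basisVector 0) x = 0 :=
    iteratedFDeriv_clm_add_two
      ((EuclideanSpace.proj (0 : Fin 4) : E4 →L[ℝ] ℝ).smulRight (E4.basisVector 0)) x l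
  -- piece 2
  have e2 : ‖iteratedFDeriv ℝ (l + 2) (fun y : E4 ↦ E4.spaceEmbed (ξ (y 0))) x‖ ≤
      ‖iteratedDeriv (l + 2) ξ (x 0)‖ := by
    have h := E4.spaceEmbed.norm_iteratedFDeriv_comp_left ((hξ.comp h0).contDiffAt) (x := x)
      (n := l + 2) hl
    refine h.trans ?_
    calc ‖(E4.spaceEmbed : E3 →L[ℝ] E4)‖ * ‖iteratedFDeriv ℝ (l + 2) (ξ ∘ fun y : E4 ↦ y 0) x‖
        ≤ 1 * ‖iteratedDeriv (l + 2) ξ (x 0)‖ :=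
          mul_le_mul norm_spaceEmbedCLM_le (norm_iteratedFDeriv_comp_time_le hξ x hl)
            (norm_nonneg _) zero_le_one
      _ = _ := one_mul _
  -- piece 3
  have e3 : ‖iteratedFDeriv ℝ (l + 2) (fun y : E4 ↦ E4.spaceEmbed (Lv (y 0) (Sp y))) x‖ ≤
      ‖iteratedDeriv (l + 2) Lv (x 0)‖ * ‖Sp x‖ +
        (l + 2 : ℕ) * ‖iteratedDeriv (l + 1) Lv (x 0)‖ *
          ‖((Lorentz.boost V hV : E4 ≃L[ℝ] E4).symm : E4 →L[ℝ] E4)‖ := by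
    have h := E4.spaceEmbed.norm_iteratedFDeriv_comp_left (hin.contDiffAt) (x := x) (n := l + 2) hl
    refine h.trans ?_
    refine (mul_le_mul_of_nonneg_right norm_spaceEmbedCLM_le (norm_nonneg _)).trans ?_
    rw [one_mul]
    have hleib := norm_iteratedFDeriv_clm_apply (f := fun y : E4 ↦ Lv (y 0)) (g := fun y ↦ Sp y)
      (N := ∞) (n := l + 2) hLp Sp.contDiff x hl
    refine hleib.trans ?_
    rw [Finset.sum_range_succ, Finset.sum_range_succ]
    have hrest : ∑ i ∈ Finset.range (l + 1), ((l + 2).choose i : ℝ) *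
        ‖iteratedFDeriv ℝ i (fun y : E4 ↦ Lv (y 0)) x‖ *
          ‖iteratedFDeriv ℝ (l + 2 - i) (fun y ↦ Sp y) x‖ = 0 := by
      refine Finset.sum_eq_zero fun i hi ↦ ?_
      have hi' : i < l + 1 := Finset.mem_range.mp hi
      obtain ⟨k, hk⟩ := Nat.exists_eq_add_of_le' (show i + 2 ≤ l + 2 by omega)
      have : l + 2 - i = k + 2 := by omega
      rw [this, show (fun y ↦ Sp y) = (Sp : E4 → E3) from rfl, iteratedFDeriv_clm_add_two Sp x k,
        norm_zero, mul_zero]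
    rw [hrest, zero_add]
    have hS1 : ‖iteratedFDeriv ℝ (l + 2 - (l + 1)) (fun y ↦ Sp y) x‖ ≤
        ‖((Lorentz.boost V hV : E4 ≃L[ℝ] E4).symm : E4 →L[ℝ] E4)‖ := by
      rw [show l + 2 - (l + 1) = 1 by omega]
      refine (norm_iteratedFDeriv_clm_one Sp x).trans ?_
      refine (ContinuousLinearMap.opNorm_comp_le _ _).trans ?_
      have h1 : ‖(E4.spatial : E4 →L[ℝ] E3)‖ ≤ 1 := norm_spatialCLM_le
      calc ‖(E4.spatial : E4 →L[ℝ] E3)‖ * _ ≤ 1 * _ := mul_le_mul_of_nonneg_right h1 (norm_nonneg _)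
        _ = _ := one_mul _
    have hS0 : ‖iteratedFDeriv ℝ (l + 2 - (l + 2)) (fun y ↦ Sp y) x‖ = ‖Sp x‖ := by
      rw [Nat.sub_self, norm_iteratedFDeriv_zero]
    have hLj : ‖iteratedFDeriv ℝ (l + 2) (fun y : E4 ↦ Lv (y 0)) x‖ ≤ ‖iteratedDeriv (l + 2) Lv (x 0)‖ :=
      norm_iteratedFDeriv_comp_time_le hLv x hl
    have hLj1 : ‖iteratedFDeriv ℝ (l + 1) (fun y : E4 ↦ Lv (y 0)) x‖ ≤
        ‖iteratedDeriv (l + 1) Lv (x 0)‖ :=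
      norm_iteratedFDeriv_comp_time_le hLv x hl1
    have hA : ((l + 2).choose (l + 2) : ℝ) * ‖iteratedFDeriv ℝ (l + 2) (fun y : E4 ↦ Lv (y 0)) x‖ *
        ‖iteratedFDeriv ℝ (l + 2 - (l + 2)) (fun y ↦ Sp y) x‖ ≤
        ‖iteratedDeriv (l + 2) Lv (x 0)‖ * ‖Sp x‖ := by
      rw [hS0, Nat.choose_self, Nat.cast_one, one_mul]
      exact mul_le_mul_of_nonneg_right hLj (norm_nonneg _)
    have hB : ((l + 2).choose (l + 1) : ℝ) * ‖iteratedFDeriv ℝ (l + 1) (fun y : E4 ↦ Lv (y 0)) x‖ *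
        ‖iteratedFDeriv ℝ (l + 2 - (l + 1)) (fun y ↦ Sp y) x‖ ≤
        (l + 2 : ℕ) * ‖iteratedDeriv (l + 1) Lv (x 0)‖ *
          ‖((Lorentz.boost V hV : E4 ≃L[ℝ] E4).symm : E4 →L[ℝ] E4)‖ := by
      rw [Nat.choose_succ_self_right]
      have : ((l + 1).succ : ℝ) = ((l + 2 : ℕ) : ℝ) := by norm_cast
      rw [this]
      exact mul_le_mul (mul_le_mul_of_nonneg_left hLj1 (Nat.cast_nonneg _)) hS1
        (norm_nonneg _) (by positivity)
    linarith
  rw [e1, zero_add]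
  calc ‖iteratedFDeriv ℝ (l + 2) (fun y : E4 ↦ E4.spaceEmbed (ξ (y 0))) x +
        iteratedFDeriv ℝ (l + 2) (fun y : E4 ↦ E4.spaceEmbed (Lv (y 0) (Sp y))) x‖
      ≤ _ := norm_add_le _ _
    _ ≤ ‖iteratedDeriv (l + 2) ξ (x 0)‖ + (‖iteratedDeriv (l + 2) Lv (x 0)‖ * ‖Sp x‖ +
        (l + 2 : ℕ) * ‖iteratedDeriv (l + 1) Lv (x 0)‖ *
          ‖((Lorentz.boost V hV : E4 ≃L[ℝ] E4).symm : E4 →L[ℝ] E4)‖) := add_le_add e2 e3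
    _ = _ := by
        rw [show l + 2 - 1 = l + 1 by omega]
        simp only [hSp, ContinuousLinearMap.comp_apply, ContinuousLinearEquiv.coe_coe]
        ring

end HonestMap

/-! ### Registered forms -/

/-- Registered sub-goal form (stub `norm_fderiv_honestMap_sub_id_le` of the crux item) of
`norm_fderiv_honestMap_sub_id_le'`. [folklore] -/
theorem norm_fderiv_honestMap_sub_id_le : open Literature.Geometry.Lorentzian in ∀ {V : E3} (hV : ‖V‖ < 1) {ξ : ℝ → E3} {Lv : ℝ → E3 →L[ℝ] E3} {Ah : E4 → E4}, (∀ x : E4, Ah x = E4.ofTimeSpace (x 0) (ξ (x 0) + Lv (x 0) (E4.spatial ((Lorentz.boost V hV : E4 ≃L[ℝ] E4).symm x)))) → ContDiff ℝ ((⊤ : ℕ∞) : WithTop ℕ∞) ξ → ContDiff ℝ ((⊤ : ℕ∞) : WithTop ℕ∞) Lv → ∀ x : E4, ‖fderiv ℝ Ah x - ContinuousLinearMap.id ℝ E4‖ ≤ ‖deriv ξ (x 0) - V‖ + ‖deriv Lv (x 0)‖ * ‖E4.spatial ((Lorentz.boost V hV : E4 ≃L[ℝ] E4).symm x)‖ +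 ‖Lv (x 0) - (ContinuousLinearMap.id ℝ E3 - (Lorentz.gamma V / (Lorentz.gamma V + 1)) • (innerSL ℝ V).smulRight V)‖ * ‖((Lorentz.boost V hV : E4 ≃L[ℝ] E4).symm : E4 →L[ℝ] E4)‖ :=
  fun hV _ _ _ hAh hξ hLv x ↦ norm_fderiv_honestMap_sub_id_le' hV hAh hξ hLv x

/-- Registered sub-goal form (stub `norm_iteratedFDeriv_honestMap_le` of the crux item) of
`norm_iteratedFDeriv_honestMap_le'`. [folklore] -/
theorem norm_iteratedFDeriv_honestMap_le : open Literature.Geometry.Lorentzian in ∀ {V : E3} (hV : ‖V‖ < 1) {ξ : ℝ → E3} {Lv : ℝ → E3 →L[ℝ] E3} {Ah : E4 → E4}, (∀ x : E4, Ah x = E4.ofTimeSpace (x 0) (ξ (x 0) + Lv (x 0) (E4.spatial ((Lorentz.boost V hV : E4 ≃L[ℝ] E4).symm x)))) → ContDiff ℝ ((⊤ : ℕ∞) : WithTop ℕ∞) ξ → ContDiff ℝ ((⊤ : ℕ∞) : WithTop ℕ∞) Lv → ∀ (x : E4) {j : ℕ}, 2 ≤ j → ‖iteratedFDeriv ℝ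 j Ah x‖ ≤ ‖iteratedDeriv j ξ (x 0)‖ + ‖iteratedDeriv j Lv (x 0)‖ * ‖E4.spatial ((Lorentz.boost V hV : E4 ≃L[ℝ] E4).symm x)‖ + j * ‖iteratedDeriv (j - 1) Lv (x 0)‖ * ‖((Lorentz.boost V hV : E4 ≃L[ℝ] E4).symm : E4 →L[ℝ] E4)‖ :=
  fun hV _ _ _ hAh hξ hLv x _ hj ↦ norm_iteratedFDeriv_honestMap_le' hV hAh hξ hLv x hj

end Summit.FinalStateConjecture.FinalStateConjecture.Theorems

end
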